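import Summits.ResolutionOfSingularities.ResolutionOfSingularities.Theses.WildQuotients
import Summits.ResolutionOfSingularities.ResolutionOfSingularities.Theorems.RadicialJungCleanModelsReduction
import Summits.ResolutionOfSingularities.ResolutionOfSingularities.Theorems.RadicialJungCleanModelsStubPrincipalizationDimLEOne
import Summits.ResolutionOfSingularities.ResolutionOfSingularities.Theorems.RadicialJungCleanModelsStubLooseCleanOfGiraudNormalFormAt
import Literature.AlgebraicGeometry.Resolution.GiraudNormalFormTransport
import Mathlib.Logic.Equiv.Fintype
import HarnessLib

/-!
# `GiraudNormalFormSep ⇒ CleanModels` (item stmt-18001 ⇒ crux stmt-15917): Giraud's uniform normal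
# form along an snc boundary implies pointwise log-clean models

Route `ResolutionOfSingularities/RadicialJung`, crux `CleanModels` (stmt-15917); seat res-L0-w81-pv-2 g3
(W8.1 brick B1 of the registered 0549 line `via-clean-models`).  The two research statements of the
Jung/Giraud family of lines for cruxes 0549 / 0554 / 0557 / RadicialJung are

* `WildQuotients.GiraudNormalFormSep` (stmt-18001): a proper birational REGULAR model `W' → W` with an snc
  boundary `E` and, locally uniformly, sections `a` representing the degree-`p` purely inseparable class whose
  germ at every point is `GiraudNormalFormAt` (wound/transversal `g^p + x^{pB} u` or Kummer `g^p + u x^A`,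
  some `p ∤ A_j`, with `x_j` the boundary equations);
* `RadicialJung.CleanModels` (stmt-15917): a proper birational REGULAR model on which, at every point, some
  representative of the class is EXACTLY log-clean (toroidal `∏ t_i^{a_i}`, `p ∤ a_i`, or regular type) —
  no boundary, no uniformity.

This file proves **`GiraudNormalFormSep → CleanModels`** (`cleanModels_of_giraudNormalFormSep`), so that the
new 0549 line `via-clean-models` (stub = 15917) DOMINATES the older `via_giraud_sep` (stub = 18001) in the
kernel.  Assembly of landed pieces of the 15917 line (lead c2): `L := K(W)[T]/(T^p - g₀)`
(`exists_purelyInseparable_of_forall_pow_ne`: purely inseparable of degree `p`, every `y ∈ L` has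
`y^p = Σ_{j<p} c_j^p g₀^j`); the Giraud model supplied by 18001; at a point, the snc boundary equations are
extended to a regular system of parameters (`exists_rsop_extending_of_hasSNC`, from `HasSNC`: an injection
of the boundary components through the point into a minimal generating system, re-enumerated by
`Equiv.extendSubtype`), the normal form is transported along the unit changes
(`GiraudNormalFormAt.reindex`) and read as LOOSE cleanness of a representative `c₀^p + c₁^p a`
(`stub_looseCleanOfGiraudNormalFormAt`); the coefficients are pulled back along the birational
`ρ^♯ : K(W) ≅ K(W')`; finally `cleanModels_of_logCleanPrincipalization` (unit absorption by Bézout, Frobenius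
twist of the generator) gives `CleanModels`.  No new mathematics; 18001 and 15917 remain open.
-/

noncomputable section

set_option linter.dupNamespace false -- mandated namespace of this single-conjunct summit

open CategoryTheory AlgebraicGeometry TopologicalSpace IsLocalRing
open Literature.AlgebraicGeometry.Resolution Literature.AlgebraicGeometry.Motives

namespace Summit.ResolutionOfSingularities.ResolutionOfSingularities.Theorems

/-- **Boundary equations of an snc boundary extend to a regular system of parameters.** At a point `x` of an
integral scheme carrying an snc boundary `E` (`HasSNC E`), given an injective enumeration `D` of some boundary
components through `x` with generators `xs j` of their stalk ideals, there is a minimal generating system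
`t : Fin d → 𝒪_{X,x}` of `𝔪_x` with `d = dim 𝒪_{X,x}` whose first `r` members are the `xs j` up to units
(`xs j = ε_j · t_j`).  From the `HasSNC` witness (a minimal generating system `u` and an injection `ι` of the
components through `x` with `(D)_x = (u_{ι D})`), re-enumerated by a permutation extending `j ↦ ι (D j)`
(`Equiv.extendSubtype`); the units come from `(xs j) = (u_{ι (D j)})` in the domain `𝒪_{X,x}`. [folklore] -/
theorem exists_rsop_extending_of_hasSNC {X : Scheme.{0}} [IsIntegral X] {E : List X.IdealSheafData}
    (hE : HasSNC E) (x : X) {r : ℕ} (D : Fin r → {D : X.IdealSheafData // D ∈ E ∧ x ∈ D.support})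
    (hD : Function.Injective D) (xs : Fin r → X.presheaf.stalk x)
    (hxs : ∀ j, stalkIdeal (D j).1 x = Ideal.span {xs j}) :
    ∃ (d : ℕ) (hrd : r ≤ d) (t : Fin d → X.presheaf.stalk x) (ε : Fin r → X.presheaf.stalk x),
      Ideal.span (Set.range t) = maximalIdeal (X.presheaf.stalk x) ∧
      ringKrullDim (X.presheaf.stalk x) = (d : WithBot ℕ∞) ∧
      (∀ j, IsUnit (ε j)) ∧ ∀ j, xs j = ε j * t (Fin.castLE hrd j) := by
  classical
  obtain ⟨hreg, u, hu, ⟨ι, hι, hιD⟩, -⟩ := hE x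
  haveI := hreg
  -- `d := emb dim = dim`
  have hφ : Function.Injective (fun j : Fin r => ι (D j)) := hι.comp hD
  have hrd : r ≤ (maximalIdeal (X.presheaf.stalk x)).spanFinrank := by
    simpa using Fintype.card_le_of_injective _ hφ
  -- a permutation `σ` of `Fin d` with `σ (castLE j) = ι (D j)`
  let e₁ : {i : Fin (maximalIdeal (X.presheaf.stalk x)).spanFinrank // (i : ℕ) < r} ≃ Fin r :=
    { toFun := fun i => ⟨i.1, i.2⟩
      invFun := fun j => ⟨Fin.castLE hrd j, j.2⟩
      left_inv := fun i => by ext; rfl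
      right_inv := fun j => by ext; rfl }
  let e : {i : Fin (maximalIdeal (X.presheaf.stalk x)).spanFinrank // (i : ℕ) < r} ≃
      {i : Fin (maximalIdeal (X.presheaf.stalk x)).spanFinrank //
        i ∈ Set.range (fun j : Fin r => ι (D j))} :=
    e₁.trans (Equiv.ofInjective _ hφ)
  let σ : Equiv.Perm (Fin (maximalIdeal (X.presheaf.stalk x)).spanFinrank) := e.extendSubtype
  have hσ : ∀ j : Fin r, σ (Fin.castLE hrd j) = ι (D j) := by
    intro j
    have h1 : σ (Fin.castLE hrd j) =
        (e ⟨Fin.castLE hrd j, j.2⟩ : Fin (maximalIdeal (X.presheaf.stalk x)).spanFinrank) :=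
      e.extendSubtype_apply_of_mem (Fin.castLE hrd j) j.2
    rw [h1]
    show ((Equiv.ofInjective _ hφ) (e₁ ⟨Fin.castLE hrd j, j.2⟩) :
      Fin (maximalIdeal (X.presheaf.stalk x)).spanFinrank) = ι (D j)
    have h2 : e₁ ⟨Fin.castLE hrd j, j.2⟩ = j := by ext; rfl
    rw [h2, Equiv.ofInjective_apply]
  -- the units
  have hassoc : ∀ j, ∃ w : (X.presheaf.stalk x)ˣ, u (ι (D j)) * w = xs j := fun j =>
    Ideal.span_singleton_eq_span_singleton.mp (((hιD (D j)).symm.trans (hxs j)))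
  choose w hw using hassoc
  refine ⟨_, hrd, u ∘ σ, fun j => (w j : X.presheaf.stalk x), ?_, ?_, fun j => (w j).isUnit, ?_⟩
  · rw [σ.surjective.range_comp u]; exact hu
  · exact hreg.spanFinrank_maximalIdeal.symm
  · intro j
    show xs j = (w j : X.presheaf.stalk x) * u (σ (Fin.castLE hrd j))
    rw [hσ, mul_comm, hw]

/-- **Log-clean principalization from Giraud's uniform normal form** — the hypothesis of
`RadicialJung.CleanModels.cleanModels_of_logCleanPrincipalization`, derived from `GiraudNormalFormSep`: for
`W` regular integral separated of finite type over `k` (char `p`) and `g₀ ∈ K(W) ∖ K(W)^p`, the Giraud model of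
the class of `L = K(W)(g₀^{1/p})` is a proper birational regular model on which, at EVERY point, some
non-trivial representative `Σ_{j<p} c_j^p g₀^j` is loosely clean. [folklore] -/
theorem logCleanPrincipalization_of_giraudNormalFormSep
    (hG : Summit.ResolutionOfSingularities.ResolutionOfSingularities.Theses.WildQuotients.GiraudNormalFormSep) :
    ∀ (p : ℕ), p.Prime → ∀ (k : Type) [Field k] [CharP k p] (W : Scheme.{0}) [IsIntegral W]
      (f : W ⟶ Spec (.of k)) [IsSeparated f] [LocallyOfFiniteType f] [QuasiCompact f],
      Scheme.IsRegular W → ∀ g₀ : W.functionField, (∀ c : W.functionField, c ^ p ≠ g₀) →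
      ∃ (V : Scheme.{0}) (π : V ⟶ W) (_ : IsIntegral V) (_ : IsDominant π),
        IsProper π ∧ IsBirational π ∧ Scheme.IsRegular V ∧
        ∀ v : V, ∃ c : Fin p → W.functionField, (∃ j : Fin p, (j : ℕ) ≠ 0 ∧ c j ≠ 0) ∧
          ((∃ (d m : ℕ) (hmd : m ≤ d) (t : Fin d → V.presheaf.stalk v) (a : Fin m → ℕ)
              (u : V.presheaf.stalk v), IsUnit u ∧
              Ideal.span (Set.range t) = IsLocalRing.maximalIdeal (V.presheaf.stalk v) ∧
              ringKrullDim (V.presheaf.stalk v) = (d : WithBot ℕ∞) ∧ 0 < m ∧ (∀ i, ¬ p ∣ a i) ∧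
              RatFn.functionFieldMap π (∑ j : Fin p, c j ^ p * g₀ ^ (j : ℕ)) =
                algebraMap (V.presheaf.stalk v) V.functionField
                  (u * ∏ i : Fin m, t (Fin.castLE hmd i) ^ (a i))) ∨
            (∃ u : V.presheaf.stalk v, IsUnit u ∧
              RatFn.functionFieldMap π (∑ j : Fin p, c j ^ p * g₀ ^ (j : ℕ)) =
                algebraMap (V.presheaf.stalk v) V.functionField u ∧
              ∀ c' : V.presheaf.stalk v,
                u - c' ^ p ∉ IsLocalRing.maximalIdeal (V.presheaf.stalk v)) ∨
            (∃ s c' : V.presheaf.stalk v,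
              RatFn.functionFieldMap π (∑ j : Fin p, c j ^ p * g₀ ^ (j : ℕ)) =
                algebraMap (V.presheaf.stalk v) V.functionField s ∧
              s - c' ^ p ∈ IsLocalRing.maximalIdeal (V.presheaf.stalk v) ∧
              s - c' ^ p ∉ IsLocalRing.maximalIdeal (V.presheaf.stalk v) ^ 2)) := by
  intro p hp k _ _ W _ f _ _ _ hWreg g₀ hg₀
  haveI : Fact p.Prime := ⟨hp⟩
  haveI : CharP W.functionField p := RadicialJung.CleanModels.charP_stalk W f _
  -- the radicial extension `L = K(W)[T]/(T^p - g₀)` with its coordinates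
  obtain ⟨L, _instF, _instA, hPI, hdeg, hcoord⟩ :=
    RadicialJung.CleanModels.exists_purelyInseparable_of_forall_pow_ne p hp g₀ hg₀
  -- Giraud's model (item 18001)
  obtain ⟨W', hW'int, ρ, hdom, E, hρ, hbir, hW'reg, hE, hNF⟩ :=
    hG p hp k W f L ‹IsSeparated f› ‹LocallyOfFiniteType f› ‹QuasiCompact f› hWreg hPI hdeg
  haveI := hW'int
  haveI := hdom
  haveI := hρ
  -- `ρ^♯ : K(W) ≅ K(W')`
  have hbij : Function.Bijective (RatFn.functionFieldMap ρ) := by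
    obtain ⟨U, hU, hU', hiso⟩ := hbir
    haveI := hiso
    exact RatFn.functionFieldMap_bijective_of_isIso_morphismRestrict ρ U hU hU'
  refine ⟨W', ρ, hW'int, hdom, hρ, hbir, hW'reg, fun v => ?_⟩
  -- the uniform normal form around `v`, read at `v` itself
  obtain ⟨U, hU, a, ⟨y, c, hy, hyp, hc⟩, hall⟩ := hNF v
  obtain ⟨r, D, xs, hDbij, hDx, hGNF⟩ := hall v hU
  haveI : IsRegularLocalRing (W'.presheaf.stalk v) := hW'reg v
  haveI : CharP (W'.presheaf.stalk v) p := RadicialJung.CleanModels.charP_stalk W' (ρ ≫ f) v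
  -- boundary equations inside a regular system of parameters; transport the normal form
  obtain ⟨d, hrd, t, ε, ht, hd, hε, hxε⟩ := exists_rsop_extending_of_hasSNC hE v D hDbij.1 xs hDx
  have hGNF' : GiraudNormalFormAt p (fun j : Fin r => t (Fin.castLE hrd j))
      (W'.presheaf.germ (U : W'.Opens) v hU a) :=
    hGNF.reindex (Equiv.refl (Fin r)) ε hε (fun j => by simpa using hxε j)
  -- loose cleanness of a representative `c₀^p + c₁^p a`
  obtain ⟨c₀, c₁, hc₁, htri⟩ :=
    RadicialJung.CleanModels.stub_looseCleanOfGiraudNormalFormAt (K := W'.functionField) p hp hrd t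
      ht hd (W'.presheaf.germ (U : W'.Opens) v hU a) hGNF'
  -- coordinates of `y`: `c = Σ e_j^p g₀^j` with some `e_j ≠ 0`, `j ≠ 0`
  obtain ⟨e, hey, hej⟩ := hcoord y
  have hyr : y ∉ Set.range (algebraMap W.functionField L) := fun h => hy (RingHom.mem_range.mpr h)
  obtain ⟨j₀, hj₀, hej₀⟩ := hej hyr
  have hc_eq : c = ∑ j : Fin p, e j ^ p * g₀ ^ (j : ℕ) :=
    (algebraMap W.functionField L).injective (by rw [hey, hyp])
  -- pull the coefficients back along `ρ^♯`
  obtain ⟨d₀, hd₀⟩ := hbij.2 c₀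
  obtain ⟨d₁, hd₁⟩ := hbij.2 c₁
  have hd₁0 : d₁ ≠ 0 := fun h => hc₁ (by rw [← hd₁, h, map_zero])
  let j0 : Fin p := ⟨0, hp.pos⟩
  let c' : Fin p → W.functionField := fun j => d₁ * e j + if j = j0 then d₀ else 0
  have hsum : ∑ j : Fin p, c' j ^ p * g₀ ^ (j : ℕ) = d₀ ^ p + d₁ ^ p * c := by
    have h1 : ∀ j : Fin p, c' j ^ p * g₀ ^ (j : ℕ) =
        d₁ ^ p * (e j ^ p * g₀ ^ (j : ℕ)) + (if j = j0 then d₀ ^ p * g₀ ^ (j : ℕ) else 0) := by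
      intro j
      show (d₁ * e j + if j = j0 then d₀ else 0) ^ p * g₀ ^ (j : ℕ) = _
      rw [add_pow_char, mul_pow]
      split_ifs with h
      · ring
      · rw [zero_pow hp.ne_zero]; ring
    rw [Finset.sum_congr rfl fun j _ => h1 j, Finset.sum_add_distrib, ← Finset.mul_sum, ← hc_eq,
      Finset.sum_ite_eq' Finset.univ j0, if_pos (Finset.mem_univ _)]
    show d₁ ^ p * c + d₀ ^ p * g₀ ^ (0 : ℕ) = d₀ ^ p + d₁ ^ p * c
    rw [pow_zero, mul_one, add_comm]
  have key : RatFn.functionFieldMap ρ (∑ j : Fin p, c' j ^ p * g₀ ^ (j : ℕ)) =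
      c₀ ^ p + c₁ ^ p * algebraMap (W'.presheaf.stalk v) W'.functionField
        (W'.presheaf.germ (U : W'.Opens) v hU a) := by
    rw [hsum, map_add, map_mul, map_pow, map_pow, hd₀, hd₁, hc]
  refine ⟨c', ⟨j₀, hj₀, ?_⟩, ?_⟩
  · have hne : j₀ ≠ j0 := fun h => hj₀ (by rw [h])
    show d₁ * e j₀ + (if j₀ = j0 then d₀ else 0) ≠ 0
    rw [if_neg hne, add_zero]
    exact mul_ne_zero hd₁0 hej₀
  · rw [key]
    exact htri

/-- **`GiraudNormalFormSep ⇒ CleanModels`** (item stmt-ResolutionOfSingularities-18001 ⇒ crux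
stmt-ResolutionOfSingularities-15917): Giraud's uniform normal form along an snc boundary on a proper
birational regular model implies the existence of POINTWISE log-clean regular models —
`logCleanPrincipalization_of_giraudNormalFormSep` fed into the 15917 line's reduction
`cleanModels_of_logCleanPrincipalization` (unit absorption by Bézout, Frobenius twist of the generator).
Hence the 0549 line `via-clean-models` dominates `via_giraud_sep`. [folklore] -/
theorem cleanModels_of_giraudNormalFormSep
    (hG : Summit.ResolutionOfSingularities.ResolutionOfSingularities.Theses.WildQuotients.GiraudNormalFormSep) :
    Summit.ResolutionOfSingularities.ResolutionOfSingularities.Theses.RadicialJung.CleanModels :=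
  RadicialJung.CleanModels.cleanModels_of_logCleanPrincipalization
    (logCleanPrincipalization_of_giraudNormalFormSep hG)

end Summit.ResolutionOfSingularities.ResolutionOfSingularities.Theorems

end
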